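import Literature.IUT.HodgeTheaters.InitialThetaDataCurveModelLaws
import Literature.IUT.HodgeTheaters.InitialThetaDataLocalCurves
import Literature.AnabelianGeometry.AbsoluteAnabelian.AbsTopIII.CurveModelSum
import Literature.AnabelianGeometry.AbsoluteAnabelian.ArchimedeanReconstruction
import HarnessLib

/-!
# [IUTchI] Def. 3.1 (e): the LOCAL / NF-point interface datum `InitialThetaData.LocalThetaGeometry` of an
# initial Θ-datum and the enriched named model `InitialThetaData.nfCurveModelLocal` (the four global curves
# WITH NF-points ⊕ the local curves `C_v`, `X_v` at the finite places of `K`)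

S. Mochizuki, *Inter-universal Teichmüller theory I*, §3, Def. 3.1 (e) (kurims final manuscript, May 2020,
pp. 62–63) [claim: Mochizuki2012, status: disputed]; S. Mochizuki, *Topics in Absolute Anabelian Geometry
III*, §1 Def. 1.7, Thm. 1.9, Cor. 1.10, §2 Cor. 2.8 [MochizukiAbsTopIII2015].  abc-iut cell, GAP B
(`G-L5t9g8-1`, [IUTchI] Ex. 5.4 (iv) ∞κ-compatibility) item **GB-13** = `GAP-SIZING-B.md` (sha16
2de24246389ab103) §2 row D7, SECOND half: "local decomposition extensions `Π_{X_v} ↪ Π_{X_K}` at good `v`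
and NF-point decomposition groups → ABSENT from `ThetaGeometry` ⇒ new interface fields or a separate
`LocalThetaGeometry` datum (R5)"; built against the chair's RULINGS #315 (2) ("`locRat`/`locInfkx`/`locInfk`
… at the genuine local data … `ratHom` = the homomorphisms induced by the given poly-morphism (Cor 1.10 / 2.8
instance)"), #316 ("[AbsTopIII] Thm 1.9 (+ Cor 1.10 local / Cor 2.8 arch) INSTANCE binders BY NAME in
ADMISSIBLE instance form") and GB-07's model `InitialThetaData.nfCurveModel` / hook `NFPointData`
(`InitialThetaDataCurveModel.lean`).  FILE 3 of the item (FILE 1 `InitialThetaDataLocalCurves.lean`: the local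
curves as extensions `Π_{X_v}, Π_{C_v} ↠ G_{K_v}` with their decomposition maps; FILE 2
`AbsTopIII/CurveModelSum.lean`: `CurveModel.sum` and the restriction lemmas).

## What is here

* `IsNFGeomPoint E P` — for a geometric point `P ∈ E(Ω)` of the elliptic curve `E/F`: its affine coordinates are
  algebraic over `F` (⇔ over `ℚ`), i.e. `P` "descends to `k̄_NF`" ([AbsTopIII] Def. 1.7 (ii)) — GENUINE;
* `InitialThetaData.LocalNFCurveIndex K` — the index `C_v | X_v` (`v : HeightOneSpectrum (𝓞 K)`, the finite
  places of `K`) of the LOCAL curves `C_v := C_K ×_K K_v`, `X_v := X_K ×_K K_v` (Def. 3.1 (e));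
* **`InitialThetaData.LocalThetaGeometry D`** — the HYPOTHESIS STRUCTURE (DATA only, consumed BY NAME, never an
  instance; R5 DECISION: point TYPES are REAL, decomposition GROUPS are interface because the `Π`'s are):
  `nfDecomp` = the decomposition group in `Π_{C_F}` of the closed point under a geometric point
  `P ∈ E(F̄) ∖ {O}` (its traces in `Π_{X_F}`, `Π_{C_K}`, `Π_{X_K}` are the preimages under GB-07's inclusions
  `homXFCF`/`homCKCF`/`homXKCF`); `locDecomp v` = the decomposition group in `Π_{C_v}` of the closed point of
  `C_v` under `P ∈ E(K_v^alg) ∖ {O}` (trace in `Π_{X_v}` via FILE 1's `locXToC`); `arch w` = the Aut-holomorphic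
  input of [AbsTopIII] Cor. 2.8 at the archimedean place `w` in the L4 shape `ArchimedeanReconstruction.NFCurveData`
  (p408225) — MODEL label: print's archimedean `π₁^{rat}` is Aut-holomorphic ([IUTchI] Def. 5.2 (vii)(viii)) —
  pinned to `Π_{X_K}` and `K_w` by `archExtIso`, `archBaseIso`;
* `G.nfPointData : D.NFPointData` — FILLS GB-07's hook: `Point := {P : E(F̄) // P ≠ O}` (REAL), `decomp` from
  `nfDecomp`, `IsNFPoint := True` (GENUINE: over a number field `k̄_NF = k̄`, GB-07's
  `kbarNF_nfCurveModelOfPoints_eq_top`) — so clause (a) of `Thm_1_9` is NON-VACUOUS at the enriched model;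
* `D.localCurveModel G : CurveModel` — the local curves: `base = K_v := v.adicCompletion K` (REAL),
  `ext = localCurveExt` (FILE 1), `galIso = Iso.refl` (the Galois group IS `absoluteGaloisGrp K_v`), REAL function
  fields `K_v(x)` / `K_v(E)` and NF-function fields `F̄(x)` / `F̄(E)`, REAL NF-predicates (algebraicity over `F`),
  closed points `E(K_v^alg) ∖ {O}` (REAL) with decomposition groups from `G` (interface), `cusps := noCusps`
  (NOT RECORDED — the local cusps live in abc-iut-L5-t2's `D.peLoc`; neither `Thm_1_9` nor `Cor_1_10_*` reads them),
  `IsStrictlyBelyiType := True` (FILLED BY PRINT as in GB-07: [AbsTopIII] Rmk. 2.8.3 + Def. 3.1 (d));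
* **`D.nfCurveModelLocal G := (D.nfCurveModelOfPoints G.nfPointData).sum (D.localCurveModel G)`** — the ENRICHED
  named model the instance binders are STATED AT, BY NAME: `(h₁₉ : Thm_1_9 (D.nfCurveModelLocal G))`,
  `(h₁₁₀ : Cor_1_10_iii (D.nfCurveModelLocal G))` (its input class `IsCor110Input = IsMLF (base)` selects the local
  curves: `K_v` is an MLF by the tree's `isMLF_adicCompletion`), `(h₂₈ : ∀ w, (G.arch w).ReconstructsAutHol)`;
  with the PROJECTIONS `thm_1_9_nfCurveModel_of_local : Thm_1_9 (D.nfCurveModelLocal G) → Thm_1_9 D.nfCurveModel`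
  (GB-09's transport is stated at GB-07's model), `cor_1_10_iii_localCurveModel_of_local` (`Cor_1_10_i/ii`: FILE 2's `.sum_inr`).

HONEST LABEL: a MODEL of the interface at the genuine datum; `Π`'s, decomposition groups and the archimedean
Aut-holomorphic data are INTERFACE (étale `π₁` / Riemann surfaces of curves are not constructed in the tree);
nothing here asserts [AbsTopIII] Thm. 1.9 / Cor. 1.10 / Cor. 2.8 at this model; typed ≠ inhabited ≠ proved;
nothing bears on the disputed [IUTchIII] Cor. 3.12, no side is taken; no `instance`, no notation.
-/

noncomputable section

namespace Literature.IUT.HodgeTheaters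

open CategoryTheory Topology NumberField IsDedekindDomain
open Literature.AnabelianGeometry.AbsoluteAnabelian
open Literature.AnabelianGeometry.AbsoluteAnabelian.AbsTopIII

universe u

/-! ### NF-points among geometric points -/

section NFPoint

variable {F : Type u} [Field F] {Ω : Type u} [Field Ω] [Algebra F Ω] (E : WeierstrassCurve F)

/-- A geometric point `P ∈ E(Ω)` of the elliptic curve `E/F` (`F` a number field, `Ω ⊇ F` a field, e.g.
`F̄` or `K_v^alg`) is an **NF-point** — "points of `X(k̄)` that descend to `k̄_NF`", [AbsTopIII] Def. 1.7 (ii)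
p. 35 — iff its affine coordinates are algebraic over `F` (equivalently over `ℚ`, `F/ℚ` being finite; `E` is
defined over `F ⊆ k̄_NF`); the point at infinity `O` descends. [cite: MochizukiAbsTopIII2015, Def 1.7 (ii) p.35] -/
def IsNFGeomPoint : GeomPoints Ω E → Prop
  | .zero => True
  | .some x y _ => IsAlgebraic F x ∧ IsAlgebraic F y

/-- An affine point is an NF-point iff both coordinates are algebraic over `F`.
[cite: MochizukiAbsTopIII2015, Def 1.7 (ii) p.35] -/
theorem isNFGeomPoint_some {x y : Ω} (h : (E.toAffine.baseChange Ω).Nonsingular x y) :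
    IsNFGeomPoint E (.some x y h) ↔ IsAlgebraic F x ∧ IsAlgebraic F y := Iff.rfl

end NFPoint

namespace InitialThetaData

/-! ### The index of the local curves -/

/-- Index of the LOCAL curves of an initial Θ-datum recorded by this file (Def. 3.1 (e): "for each
`v ∈ 𝕍(K)` … base-changing hyperbolic orbicurves over `F` or `K` to `K_v`"): `C_v := C_K ×_K K_v` and
`X_v := X_K ×_K K_v` at a finite place `v` of `K`.  NOT indexed: `X̲_v`, `C̲_v`, `X̲→_v` (print's `Π_v`, the
tree's `D.PiLoc D.PiXarrow`), `C̲→_v` — their function fields are not determined by the datum's REAL data (as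
for GB-07's global index); the archimedean `v` (Aut-holomorphic, see `LocalThetaGeometry.arch`).  (No `deriving`:
no instance is declared.) [claim: Mochizuki2012, status: disputed] -/
inductive LocalNFCurveIndex (K : Type u) [Field K] : Type u
  /-- `C_v := C_K ×_K K_v` -/
  | C (v : HeightOneSpectrum (𝓞 K))
  /-- `X_v := X_K ×_K K_v` -/
  | X (v : HeightOneSpectrum (𝓞 K))

namespace LocalNFCurveIndex

variable {K : Type u} [Field K]

/-- The place `v` of the local curve. [claim: Mochizuki2012, status: disputed] -/
def place : LocalNFCurveIndex K → HeightOneSpectrum (𝓞 K)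
  | C v => v
  | X v => v

/-- `X_v` is a scheme-like curve, `C_v` an orbicurve. [claim: Mochizuki2012, status: disputed] -/
def IsScheme : LocalNFCurveIndex K → Prop
  | C _ => False
  | X _ => True

/-- Genus of the (coarse) compactification: `0` for `C_v`, `1` for `X_v`. [claim: Mochizuki2012, status: disputed] -/
def genus : LocalNFCurveIndex K → ℕ
  | C _ => 0
  | X _ => 1

end LocalNFCurveIndex

section Model

variable {F K Fbar : Type u} [Field F] [NumberField F] [Field K] [NumberField K] [Algebra F K]
  [Field Fbar] [Algebra F Fbar] [Algebra K Fbar] {E : WeierstrassCurve F} [E.IsElliptic] {l : ℕ}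
  {Pb : BadPlacePredicates K} (D : InitialThetaData F K Fbar E l Pb)

/-- The extensions `Π_{C_v} ↠ G_{K_v}`, `Π_{X_v} ↠ G_{K_v}` of the local curves (FILE 1: `extLocC`, `extLocX`,
base changes `Π_{(−)_K} ×_{G_F} G_{K_v}` by the tree adapters A1/A8). [claim: Mochizuki2012, status: disputed] -/
def localCurveExt : LocalNFCurveIndex K → FundamentalExtension.{u}
  | .C v => D.extLocC v
  | .X v => D.extLocX v

/-- `Π_{C_v}`. [claim: Mochizuki2012, status: disputed] -/
@[simp] theorem localCurveExt_C (v : HeightOneSpectrum (𝓞 K)) : D.localCurveExt (.C v) = D.extLocC v := rfl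

/-- `Π_{X_v}`. [claim: Mochizuki2012, status: disputed] -/
@[simp] theorem localCurveExt_X (v : HeightOneSpectrum (𝓞 K)) : D.localCurveExt (.X v) = D.extLocX v := rfl

/-! ### The hypothesis structure -/

/-- **`D.LocalThetaGeometry` — the LOCAL / NF-point INTERFACE datum of an initial Θ-datum** (GAP-SIZING-B row D7
second half, R5: "ABSENT from `ThetaGeometry` ⇒ typed as an explicit interface datum, consumed BY NAME, never an
instance").  DATA only; every field is an object print USES at this point of [IUTchI] (Def. 3.1 (e), Ex. 5.1
(v), Def. 5.2 (v)–(viii), Ex. 5.4 (iv)) and that the tree cannot construct because the fundamental groups are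
interface data.  R5 DECISION: the point TYPES are REAL (geometric points of `E` minus the origin, over `F̄` resp.
`K_v^alg`); the decomposition GROUPS are interface; the archimedean input is the L4 `NFCurveData` shim, labelled.
* `nfDecomp P` — the decomposition group `D_P ⊆ Π_{C_F}` of the closed point of `C_F` lying under the geometric
  point `P ∈ E(F̄) ∖ {O} = X_F(F̄)` ([AbsTopIII] Thm. 1.9 (a) "decomposition groups of NF-points in `Π_X`"; over
  the number fields `F`, `K` EVERY closed point is an NF-point).  Its traces `D_P ∩ Π_{X_F}`, `∩ Π_{C_K}`,
  `∩ Π_{X_K}` are the decomposition groups in the three covers (`nfPointData`);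
* `locDecomp v P` — the decomposition group in `Π_{C_v}` of the closed point of `C_v` under
  `P ∈ E(K_v^alg) ∖ {O}` ([AbsTopIII] Cor. 1.10 (e) "decomposition groups of arbitrary closed points"); trace in
  `Π_{X_v}` via `locXToC`;
* `arch w` — for an archimedean place `w` of `K`, the Aut-holomorphic reconstruction INPUT of [AbsTopIII] Cor. 2.8
  (NF-points, NF-rational functions, values, `k̄_NF ↪ k_w`) in the L4 shape `ArchimedeanReconstruction.NFCurveData`
  — MODEL LABEL: print's `‡𝒟_v` at `v ∈ 𝕍^arc` is an Aut-holomorphic orbispace and `π₁^{rat}(‡𝒟_v)` is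
  Aut-holomorphic ([IUTchI] Def. 4.1 (v), Def. 5.2 (vii)(viii)); the shim is recorded AT `X_K` (the curve whose
  function field the datum determines; print's `X̲→_v → X_v` is finite étale) and pinned by `archExtIso` (its `Π`
  IS `Π_{X_K}`) and `archBaseIso` (its `k_v` IS the completion `K_w`).
Consumers (GB-08 countersign, GB-14 producer) bind `(G : D.LocalThetaGeometry)` and the instance binders at
`D.nfCurveModelLocal G` BY NAME.  Nothing is asserted. [claim: Mochizuki2012, status: disputed] -/
structure LocalThetaGeometry where
  /-- decomposition group in `Π_{C_F}` of the closed point under `P ∈ E(F̄) ∖ {O}` (interface) -/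
  nfDecomp : {P : GeomPoints Fbar E // P ≠ 0} → Subgroup D.PiC
  /-- decomposition group in `Π_{C_v}` of the closed point of `C_v` under `P ∈ E(K_v^alg) ∖ {O}` (interface) -/
  locDecomp : ∀ v : HeightOneSpectrum (𝓞 K),
    {P : GeomPoints (AlgebraicClosure (v.adicCompletion K)) E // P ≠ 0} → Subgroup (D.extLocC v).arith
  /-- the [AbsTopIII] Cor. 2.8 Aut-holomorphic input at the archimedean place `w` (L4 shim; MODEL label) -/
  arch : InfinitePlace K → ArchimedeanReconstruction.NFCurveData
  /-- … whose `Π_X ↠ G_k` is (bicontinuously isomorphic to) `Π_{X_K}` … -/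
  archExtIso : ∀ w, (arch w).ext.arith ≃ₜ* (D.nfCurveExt .XK).arith
  /-- … and whose archimedean completion `k_v` is `K_w` -/
  archBaseIso : ∀ w : InfinitePlace K, (arch w).kv ≃+* w.Completion

namespace LocalThetaGeometry

variable {D} (G : D.LocalThetaGeometry)

/-- **GB-07's closed-point hook FILLED**: for each of `C_F, X_F, C_K, X_K` the closed points are indexed by the
geometric points `E(F̄) ∖ {O}` (REAL type; a closed point = a Galois orbit, listed with repetitions — harmless in
the set-builder clause (a) of `Thm_1_9`), the decomposition groups are `nfDecomp P` resp. its preimages under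
`Π_{X_F}, Π_{C_K}, Π_{X_K} ↪ Π_{C_F}` (GB-07's `homXFCF`, `homCKCF`, `homXKCF`), and EVERY point is an NF-point
(`k̄_NF = k̄` over a number field: GB-07's `kbarNF_nfCurveModelOfPoints_eq_top`).
[claim: Mochizuki2012, status: disputed] -/
def nfPointData : D.NFPointData where
  Point := fun _ => {P : GeomPoints Fbar E // P ≠ 0}
  decomp := fun i => match i with
    | .CF => fun P => G.nfDecomp P
    | .XF => fun P => (G.nfDecomp P).comap D.homXFCF.arith.toMonoidHom
    | .CK => fun P => (G.nfDecomp P).comap D.homCKCF.arith.toMonoidHom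
    | .XK => fun P => (G.nfDecomp P).comap D.homXKCF.arith.toMonoidHom
  IsNFPoint := fun _ _ => True

/-- The closed points of every global curve are indexed by `E(F̄) ∖ {O}`. [claim: Mochizuki2012, status: disputed] -/
@[simp] theorem nfPointData_point (i : NFCurveIndex) :
    G.nfPointData.Point i = {P : GeomPoints Fbar E // P ≠ 0} := rfl

/-- Every closed point of a global curve is an NF-point. [claim: Mochizuki2012, status: disputed] -/
@[simp] theorem nfPointData_isNFPoint (i : NFCurveIndex) (P : G.nfPointData.Point i) :
    G.nfPointData.IsNFPoint i P := trivial

/-- Decomposition groups in `Π_{C_F}` are `nfDecomp`. [claim: Mochizuki2012, status: disputed] -/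
theorem nfPointData_decomp_CF (P : {P : GeomPoints Fbar E // P ≠ 0}) :
    G.nfPointData.decomp .CF P = G.nfDecomp P := rfl

/-! ### The local curve model -/

/-- **The LOCAL curves of the datum as an `[AbsTopIII] CurveModel`** (Def. 3.1 (e); index
`ULift (LocalNFCurveIndex K)` = `{C_v, X_v : v a finite place of K}`).  Field by field (REAL / INTERFACE / NOT
RECORDED as in GB-07's `nfCurveModelOfPoints`):
* `base = K_v := v.adicCompletion K` (REAL; characteristic zero as `K ⊆ K_v`); `ext = localCurveExt` (FILE 1:
  `Π_{(−)_K} ×_{G_F} G_{K_v}` over the INTERFACE `Π_{C_F}`); `galIso = Iso.refl` (the Galois group IS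
  `absoluteGaloisGrp K_v`);
* `cusps := noCusps` — NOT RECORDED (the local cusps and their decomposition groups live in abc-iut-L5-t2's
  `D.peLoc`; neither `Thm_1_9` nor `Cor_1_10_*` reads `cusps`); `IsProper := False`, `IsScheme`, `genus` REAL;
* `FunctionField = K_v(x)` (`RatFunc`) / `K_v(E)` (Mathlib's function field of the Weierstrass curve) — REAL;
  `NFFunctionField = F̄(x)` / `F̄(E)` — REAL ([AbsTopIII] Thm. 1.9 (d): `X_v ×_{K_v} K_v^alg` descends to
  `k̄_NF ≅ F̄` as `E_{F̄}`);
* `Point = E(K_v^alg) ∖ {O}` (REAL), `decomp` from `G.locDecomp` (INTERFACE; trace in `Π_{X_v}` via `locXToC`),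
  `IsNFPoint` = coordinates algebraic over `F` (GENUINE, `IsNFGeomPoint`);
* `IsNFCurve := True` (GENUINE: base change of a curve over the number field `K`); `IsNFConstant c` = `c`
  algebraic over `F` (GENUINE: `c ∈ k̄_NF ∩ K_v`); `IsNFRational f` = `f` algebraic over `F(x)` ⊆ `K_v(x)`,
  `K_v(E)` (GENUINE: `F^alg ∩ K_v` is algebraically closed in `K_v`, so the `F(x)`-algebraic elements of
  `K_v(x)`, `K_v(E)` are exactly the functions defined over `k̄_NF`);
* `IsStrictlyBelyiType := True` — FILLED BY PRINT as in GB-07 ([AbsTopIII] Rmk. 2.8.3, Def. 3.1 (d));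
  `IsCofiniteOpen := False`.
The Cor-1.10 input class `IsCor110Input = IsMLF K_v` holds at every local curve (the tree's
`isMLF_adicCompletion`, `NumberFieldValuationProSetDecomposition.lean`).  HONEST LABEL as in the module
docstring. [claim: Mochizuki2012, status: disputed] -/
def localCurveModel : CurveModel.{u} where
  Curve := ULift.{u + 1} (LocalNFCurveIndex K)
  base U := (U.down.place).adicCompletion K
  instField _ := inferInstance
  instCharZero _ := charZero_of_injective_algebraMap (algebraMap K _).injective
  ext U := D.localCurveExt U.down
  galIso U := match U with
    | ⟨.C _⟩ => Iso.refl _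
    | ⟨.X _⟩ => Iso.refl _
  cusps U := noCusps (D.localCurveExt U.down)
  IsProper _ := False
  IsScheme U := U.down.IsScheme
  genus U := U.down.genus
  FunctionField U := match U with
    | ⟨.C v⟩ => RatFunc (v.adicCompletion K)
    | ⟨.X v⟩ => (E.baseChange (v.adicCompletion K)).toAffine.FunctionField
  instFunctionField U := match U with
    | ⟨.C v⟩ => (inferInstance : Field (RatFunc (v.adicCompletion K)))
    | ⟨.X v⟩ => (inferInstance : Field (E.baseChange (v.adicCompletion K)).toAffine.FunctionField)
  instAlgebra U := match U with
    | ⟨.C v⟩ => (inferInstance : Algebra (v.adicCompletion K) (RatFunc (v.adicCompletion K)))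
    | ⟨.X v⟩ => (inferInstance :
        Algebra (v.adicCompletion K) (E.baseChange (v.adicCompletion K)).toAffine.FunctionField)
  Point U := {P : GeomPoints (AlgebraicClosure ((U.down.place).adicCompletion K)) E // P ≠ 0}
  decomp U := match U with
    | ⟨.C v⟩ => fun P => G.locDecomp v P
    | ⟨.X v⟩ => fun P => (G.locDecomp v P).comap (D.locXToC v).arith.toMonoidHom
  IsNFCurve _ := True
  IsNFPoint _ P := IsNFGeomPoint E P.1
  IsNFRational U := match U with
    | ⟨.C v⟩ => fun f =>
        IsAlgebraic (Algebra.adjoin F ({RatFunc.X} : Set (RatFunc (v.adicCompletion K)))) f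
    | ⟨.X v⟩ => fun f =>
        IsAlgebraic (Algebra.adjoin F
          ({algebraMap (E.baseChange (v.adicCompletion K)).toAffine.CoordinateRing
              (E.baseChange (v.adicCompletion K)).toAffine.FunctionField
              (WeierstrassCurve.Affine.CoordinateRing.mk _ (Polynomial.C Polynomial.X))} :
            Set (E.baseChange (v.adicCompletion K)).toAffine.FunctionField)) f
  IsNFConstant _ c := IsAlgebraic F c
  NFFunctionField U := match U with
    | ⟨.C _⟩ => RatFunc Fbar
    | ⟨.X _⟩ => (E.baseChange Fbar).toAffine.FunctionField
  instNFFunctionField U := match U with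
    | ⟨.C _⟩ => (inferInstance : Field (RatFunc Fbar))
    | ⟨.X _⟩ => (inferInstance : Field (E.baseChange Fbar).toAffine.FunctionField)
  IsStrictlyBelyiType _ := True
  IsCofiniteOpen _ _ := False
  res h := h.elim

/-- The local curve indexed by `i`. [claim: Mochizuki2012, status: disputed] -/
abbrev localCurve (i : LocalNFCurveIndex K) : (G.localCurveModel).Curve := ULift.up i

/-- `base (C_v) = base (X_v) = K_v`. [claim: Mochizuki2012, status: disputed] -/
@[simp] theorem localCurveModel_base (U : G.localCurveModel.Curve) :
    G.localCurveModel.base U = (U.down.place).adicCompletion K := rfl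

/-- `ext` is `localCurveExt`. [claim: Mochizuki2012, status: disputed] -/
@[simp] theorem localCurveModel_ext (U : G.localCurveModel.Curve) :
    G.localCurveModel.ext U = D.localCurveExt U.down := rfl

/-- `Π_{X_v}` of the model is FILE 1's `D.extLocX v`. [claim: Mochizuki2012, status: disputed] -/
theorem localCurveModel_ext_X (v : HeightOneSpectrum (𝓞 K)) :
    G.localCurveModel.ext (G.localCurve (.X v)) = D.extLocX v := rfl

/-- `Π_{C_v}` of the model is FILE 1's `D.extLocC v`. [claim: Mochizuki2012, status: disputed] -/
theorem localCurveModel_ext_C (v : HeightOneSpectrum (𝓞 K)) :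
    G.localCurveModel.ext (G.localCurve (.C v)) = D.extLocC v := rfl

/-- `K_{X_v} = K_v(E)`. [claim: Mochizuki2012, status: disputed] -/
theorem localCurveModel_functionField_X (v : HeightOneSpectrum (𝓞 K)) :
    G.localCurveModel.FunctionField (G.localCurve (.X v)) =
      (E.baseChange (v.adicCompletion K)).toAffine.FunctionField := rfl

/-- The Cor-1.10 input class at a local curve is "`K_v` is an MLF". [claim: Mochizuki2012, status: disputed] -/
theorem localCurveModel_isCor110Input_iff (U : G.localCurveModel.Curve) :
    G.localCurveModel.IsCor110Input U ↔
      Literature.AnabelianGeometry.AbsoluteAnabelian.IsMLF ((U.down.place).adicCompletion K) :=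
  Iff.rfl

end LocalThetaGeometry

/-! ### The enriched named model -/

/-- **`D.nfCurveModelLocal G` — the ENRICHED named model of the initial Θ-datum** (GAP-SIZING-B row D7, both
halves): GB-07's four GLOBAL curves `C_F, X_F, C_K, X_K` WITH their NF-point data (`nfCurveModelOfPoints
G.nfPointData`) ⊕ the LOCAL curves `C_v, X_v` (`localCurveModel`), via `CurveModel.sum`.  This is the model
the instance binders of RULINGS #315 (2) / #316 are STATED AT, BY NAME:
`(h₁₉ : Thm_1_9 (D.nfCurveModelLocal G))` — clause (a) NON-VACUOUS (NF-points recorded); implies GB-07's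
binder (`thm_1_9_nfCurveModel_of_local`) —, `(h₁₁₀ : Cor_1_10_iii (D.nfCurveModelLocal G))` — speaks about
exactly the curves with MLF base, i.e. the local ones —, and `(h₂₈ : ∀ w, (G.arch w).ReconstructsAutHol)`.
HONEST LABEL: see the module docstring. [claim: Mochizuki2012, status: disputed] -/
def nfCurveModelLocal (G : D.LocalThetaGeometry) : CurveModel.{u} :=
  (D.nfCurveModelOfPoints G.nfPointData).sum G.localCurveModel

variable (G : D.LocalThetaGeometry)

/-- The global curve `i` inside the enriched model. [claim: Mochizuki2012, status: disputed] -/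
abbrev globalCurve (i : NFCurveIndex) : (D.nfCurveModelLocal G).Curve := Sum.inl (ULift.up i)

/-- The local curve `i` inside the enriched model. [claim: Mochizuki2012, status: disputed] -/
abbrev locCurve (i : LocalNFCurveIndex K) : (D.nfCurveModelLocal G).Curve := Sum.inr (ULift.up i)

/-- A global curve keeps GB-07's extension `nfCurveExt`. [claim: Mochizuki2012, status: disputed] -/
@[simp] theorem nfCurveModelLocal_ext_global (i : NFCurveIndex) :
    (D.nfCurveModelLocal G).ext (D.globalCurve G i) = D.nfCurveExt i := rfl

/-- A local curve has FILE 1's extension. [claim: Mochizuki2012, status: disputed] -/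
@[simp] theorem nfCurveModelLocal_ext_local (i : LocalNFCurveIndex K) :
    (D.nfCurveModelLocal G).ext (D.locCurve G i) = D.localCurveExt i := rfl

/-- A local curve has base field `K_v`. [claim: Mochizuki2012, status: disputed] -/
@[simp] theorem nfCurveModelLocal_base_local (i : LocalNFCurveIndex K) :
    (D.nfCurveModelLocal G).base (D.locCurve G i) = (i.place).adicCompletion K := rfl

/-- The NF-points of a global curve of the enriched model: `E(F̄) ∖ {O}`, all of them NF-points — clause (a) of
`Thm_1_9 (D.nfCurveModelLocal G)` is NOT vacuous. [claim: Mochizuki2012, status: disputed] -/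
theorem nfCurveModelLocal_point_global (i : NFCurveIndex) :
    (D.nfCurveModelLocal G).Point (D.globalCurve G i) = {P : GeomPoints Fbar E // P ≠ 0} := rfl

/-- Every global curve of the enriched model is an input of [AbsTopIII] Thm. 1.9 (GB-07's
`isThm19Input_nfCurveModelOfPoints`). [claim: Mochizuki2012, status: disputed] -/
theorem isThm19Input_global (i : NFCurveIndex) : (D.nfCurveModelLocal G).IsThm19Input (D.globalCurve G i) :=
  (CurveModel.sum_isThm19Input_inl (D.nfCurveModelOfPoints G.nfPointData) G.localCurveModel (ULift.up i)).2
    (D.isThm19Input_nfCurveModelOfPoints G.nfPointData (ULift.up i))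

/-- The Cor-1.10 input class at a local curve of the enriched model is "`K_v` is an MLF".
[claim: Mochizuki2012, status: disputed] -/
theorem isCor110Input_local_iff (i : LocalNFCurveIndex K) :
    (D.nfCurveModelLocal G).IsCor110Input (D.locCurve G i) ↔
      Literature.AnabelianGeometry.AbsoluteAnabelian.IsMLF ((i.place).adicCompletion K) :=
  Iff.rfl

/-! ### Projections of the instance binders -/

/-- **`Thm_1_9 (D.nfCurveModelLocal G) → Thm_1_9 D.nfCurveModel`**: the binder at the enriched model implies
GB-07's binder (restrict to the global summand, then truncate the point output —
`thm_1_9_nfCurveModel_of_points`); so GB-09's transport, stated at `D.nfCurveModel`, is fed from `h₁₉`.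
[claim: Mochizuki2012, status: disputed] -/
theorem thm_1_9_nfCurveModel_of_local (h : Thm_1_9 (D.nfCurveModelLocal G)) : Thm_1_9 D.nfCurveModel :=
  D.thm_1_9_nfCurveModel_of_points _ h.sum_inl

/-- `Thm_1_9` at the enriched model gives `Thm_1_9` at the points-enriched global model (NF-points kept).
[claim: Mochizuki2012, status: disputed] -/
theorem thm_1_9_nfCurveModelOfPoints_of_local (h : Thm_1_9 (D.nfCurveModelLocal G)) :
    Thm_1_9 (D.nfCurveModelOfPoints G.nfPointData) :=
  h.sum_inl

/-- `Thm_1_9` at the enriched model gives `Thm_1_9` at the local model. [claim: Mochizuki2012, status: disputed] -/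
theorem thm_1_9_localCurveModel_of_local (h : Thm_1_9 (D.nfCurveModelLocal G)) : Thm_1_9 G.localCurveModel :=
  h.sum_inr

/-- **`Cor_1_10_iii (D.nfCurveModelLocal G) → Cor_1_10_iii G.localCurveModel`**: the local binder restricted
to the local curves. [claim: Mochizuki2012, status: disputed] -/
theorem cor_1_10_iii_localCurveModel_of_local (h : Cor_1_10_iii (D.nfCurveModelLocal G)) :
    Cor_1_10_iii G.localCurveModel :=
  h.sum_inr

end Model

end InitialThetaData

end Literature.IUT.HodgeTheaters

end
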